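import Mathlib
import Summits.Ventures.PercRepro.TriangleCapBelowWindow
import Summits.Ventures.PercRepro.TriangleCapFiveRowFourB2Pieces

/-!
# PercRepro — THE ROWS `r = a − 2` AND `r = a − 1` OF THE STABILITY TABLE AT A GENERAL `a`, THE PIECES: the window,
the sides of an `a`-bipartite `D − z`, and the deletion arithmetic at the target
`Σ_v d(v)² + r (k − 1 − r) + 2 (k − 2a − 1) ≤ m k` (p3, gen 47; part 200h)

On the cells `(k, a, a − 2)` (the one-triangle family `T`) and `(k, a, a − 1)` (the family `B2`) the non-bipartite gap
is `2 (k − 2a − 1)` in both cases. With no vertex at the cap, every degree `≥ a` gives the target by the window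
`[a, k − a − 1]` (`rowT_window`: `a (k − 2a) ≥ 2 (k − 2a − 1)`); an `a`-bipartite `D − z` makes `D` `a`-bipartite
(all neighbours of `z` on the side), or `(a + 1)`-bipartite with `k − 2a − 1 + r` missing pairs — at most the target
(all neighbours off the side, `below_bip_assemble`), or mixed with `T + (k − a − 2) ≤ d (k − a − 2) + a`
(`sides_T_gen`). The mixed arithmetic (`rowT_mixed_arith`, `rowB_mixed_arith`): slack `6 + 2q + 2e (q + 1 − e)`
resp. `6 + 2q + 2e (q + 2 − e)` with `a = q + 5`, `d = a − 1 − e`; the envelope read of `d = 1` on the `B2` row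
(`rowB_env_arith`) is EXACTLY the family `B2`; the deletion of a vertex of degree `a − 1` on the `B2` row onto the `T`
cell `(k − 1, a, a − 2)` (`rowB_T_arith`): slack `6 + 2q`. Axioms: standard.
-/

namespace PercRepro

namespace TriangleCap

namespace C047

open Finset

variable {V : Type*} [Fintype V] [DecidableEq V]

omit [DecidableEq V] in
/-- **THE WINDOW `[a, k − a − 1]` ON `(k, a, r)` AT THE TARGET `2 (k − 2a − 1)`:** every degree in `[a, k − a − 1]`
gives `Σ_v d(v)² + r (k − 1 − r) + 2 (k − 2a − 1) ≤ m k` (`2 ≤ a`, `r ≤ a`, `2a + 1 ≤ k`). -/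
theorem rowT_window (D : SimpleGraph V) [DecidableRel D.Adj] (a r : ℕ) (ha2 : 2 ≤ a) (hr : r ≤ a)
    (hk : 2 * a + 1 ≤ Fintype.card V) (hm : D.edgeFinset.card + r = a * (Fintype.card V - a))
    (hcap : ∀ v, deg D v + a + 1 ≤ Fintype.card V) (hdeg : ∀ v, a ≤ deg D v) :
    ∑ v, deg D v * deg D v + r * (Fintype.card V - 1 - r) + 2 * (Fintype.card V - 2 * a - 1) ≤
      D.edgeFinset.card * Fintype.card V := by
  have h := below_window_gen D a r hr hk hm hcap hdeg
  have h2 : 2 * (Fintype.card V - 2 * a) ≤ a * (Fintype.card V - 2 * a) := Nat.mul_le_mul_right _ ha2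
  omega

/-- **THE SIDES OF AN `a`-BIPARTITE `D − z` ON THE CELL `(k, a, r)`, `r + 1 ≤ a`, `2a + 2 ≤ k`:** `D` is
`a`-bipartite, or at the target `2 (k − 2a − 1)` (all neighbours of `z` off the side: `(a + 1)`-bipartite with
`k − 2a − 1 + r` missing pairs), or a neighbour of `z` lies off the `a`-side and `T + (k − a − 2) ≤ d(z) (k − a − 2) + a`. -/
theorem sides_T_gen (D : SimpleGraph V) [DecidableRel D.Adj] (a r : ℕ) (hr : r + 1 ≤ a)
    (hk : 2 * a + 2 ≤ Fintype.card V) (hm : D.edgeFinset.card + r = a * (Fintype.card V - a)) (z : V)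
    (A' : Finset {v : V // v ≠ z}) (hA'card : A'.card = a) (hB : BipSub (del D z) A')
    (hcap : ∀ v, deg D v ≤ (Fintype.card V - a - 2) + 1) :
    (∃ A : Finset V, A.card = a ∧ BipSub D A) ∨
      (∑ v, deg D v * deg D v + r * (Fintype.card V - 1 - r) + 2 * (Fintype.card V - 2 * a - 1) ≤
        D.edgeFinset.card * Fintype.card V) ∨
      (∑ w : {v : V // v ≠ z}, (if D.Adj w.1 z then deg (del D z) w else 0) + (Fintype.card V - a - 2) ≤
        deg D z * (Fintype.card V - a - 2) + a) := by
  by_cases hall : ∀ w : {v : V // v ≠ z}, D.Adj w.1 z → w ∈ A'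
  · obtain ⟨B, hBcard, hBsub⟩ := bipSub_lift D z A' hB hall
    exact Or.inl ⟨B, by rw [hBcard, hA'card], hBsub⟩
  by_cases hnone : ∀ w : {v : V // v ≠ z}, D.Adj w.1 z → w ∉ A'
  · right; left
    obtain ⟨A, hAcard, hAsub⟩ := bipSub_insert_of_nbhd_off D z A' hB hnone
    rw [hA'card] at hAcard
    have hbip := sum_deg_sq_le_of_bipSub D A hAsub (a + 1) (Fintype.card V - 2 * a - 1 + r) hAcard
      (below_bip_edges a r (Fintype.card V) D.edgeFinset.card hk hm) (by omega)
    have h := below_bip_assemble a r (Fintype.card V) _ _ (by omega) hk hbip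
    have h1 : 2 * (Fintype.card V - 2 * a - 1) * 1 ≤ 2 * (Fintype.card V - 2 * a - 1) * (a - r) :=
      Nat.mul_le_mul_left _ (by omega)
    omega
  · right; right
    push Not at hall
    obtain ⟨w₀, hw₀z, hw₀A⟩ := hall
    obtain ⟨Nz, hNzdef⟩ : ∃ Nz : Finset {v : V // v ≠ z},
        Nz = univ.filter (fun w : {v : V // v ≠ z} => D.Adj w.1 z) := ⟨_, rfl⟩
    have hmemNz : ∀ w : {v : V // v ≠ z}, w ∈ Nz ↔ D.Adj w.1 z := fun w => by
      rw [hNzdef, mem_filter]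
      simp only [mem_univ, true_and]
    have hNz : Nz.card = deg D z := by rw [hNzdef]; exact card_nbhd_del D z
    have hTfilt : ∑ w : {v : V // v ≠ z}, (if D.Adj w.1 z then deg (del D z) w else 0) =
        ∑ w ∈ Nz, deg (del D z) w := by
      rw [hNzdef, sum_filter]
    rw [hTfilt, ← hNz]
    have hdw₀ : deg (del D z) w₀ ≤ a := by
      have := deg_le_card_of_bipSub (del D z) A' hB w₀ hw₀A
      rw [hA'card] at this
      exact this
    exact sum_le_of_mem_le_gen Nz (fun w => deg (del D z) w) (Fintype.card V - a - 2) a ((hmemNz w₀).mpr hw₀z)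
      (fun w hw => by
        have h := deg_del D z w
        rw [if_pos ((hmemNz w).mp hw)] at h
        have := hcap w.1
        omega) hdw₀

/-- The mixed deletion on the row `r = a − 2`, `2 ≤ d ≤ a − 1`, `D − z` `a`-bipartite on `(k − 1, a, r′)`,
`r′ = d − 2`: slack `6 + 2q + 2e (q + 1 − e)` (`a = q + 5`, `d = a − 1 − e`). -/
theorem rowT_mixed_arith (a r r' d k m' S' T : ℕ) (ha : 5 ≤ a) (hr : r + 2 = a) (hd2 : 2 ≤ d) (hda : d + 1 ≤ a)
    (hk : 2 * a + r ≤ k) (hrd : r + d = a + r') (hmd : m' + d + r = a * (k - a))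
    (hS' : S' + r' * (k - 1 - 1 - r') ≤ m' * (k - 1)) (hT : T + (k - a - 2) ≤ d * (k - a - 2) + a) :
    S' + 2 * T + d + d * d + r * (k - 1 - r) + 2 * (k - 2 * a - 1) ≤ (m' + d) * k := by
  obtain ⟨q, rfl⟩ : ∃ q, a = q + 5 := ⟨a - 5, by omega⟩
  obtain rfl : r = q + 3 := by omega
  obtain ⟨e, he⟩ : ∃ e, d + e = q + 4 := ⟨q + 4 - d, by omega⟩
  obtain rfl : d = q + 4 - e := by omega
  have he2 : e ≤ q + 2 := by omega
  obtain rfl : r' = q + 2 - e := by omega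
  obtain ⟨c, rfl⟩ : ∃ c, k = 3 * q + 13 + c := ⟨k - (3 * q + 13), by omega⟩
  have e1 : 3 * q + 13 + c - 1 - 1 - (q + 2 - e) = 2 * q + 9 + c + e := by omega
  have e2 : 3 * q + 13 + c - 1 = 3 * q + 12 + c := by omega
  have e3 : 3 * q + 13 + c - (q + 5) - 2 = 2 * q + 6 + c := by omega
  have e4 : 3 * q + 13 + c - 1 - (q + 3) = 2 * q + 9 + c := by omega
  have e5 : 3 * q + 13 + c - 2 * (q + 5) - 1 = q + 2 + c := by omega
  have e6 : 3 * q + 13 + c - (q + 5) = 2 * q + 8 + c := by omega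
  obtain ⟨d, hd⟩ : ∃ d, d = q + 4 - e := ⟨_, rfl⟩
  have hd' : d + e = q + 4 := by omega
  rw [← hd] at hT hmd ⊢
  rw [e1] at hS'
  rw [e2] at hS'
  rw [e3] at hT
  rw [e4, e5]
  rw [e6] at hmd
  obtain rfl : d = q + 4 - e := hd
  obtain ⟨d', rfl⟩ : ∃ d', q + 4 - e = d' := ⟨_, rfl⟩
  have hee : e * e ≤ e * (q + 2) := Nat.mul_le_mul_left e he2
  nlinarith [hS', hT, hmd, hee, hd']

/-- The mixed deletion on the row `r = a − 1`, `2 ≤ d ≤ a − 1`, `D − z` `a`-bipartite on `(k − 1, a, r′)`,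
`r′ = d − 1`: slack `6 + 2q + 2e (q + 2 − e)`. -/
theorem rowB_mixed_arith (a r r' d k m' S' T : ℕ) (ha : 5 ≤ a) (hr : r + 1 = a) (hd2 : 2 ≤ d) (hda : d + 1 ≤ a)
    (hk : 2 * a + r ≤ k) (hrd : r + d = a + r') (hmd : m' + d + r = a * (k - a))
    (hS' : S' + r' * (k - 1 - 1 - r') ≤ m' * (k - 1)) (hT : T + (k - a - 2) ≤ d * (k - a - 2) + a) :
    S' + 2 * T + d + d * d + r * (k - 1 - r) + 2 * (k - 2 * a - 1) ≤ (m' + d) * k := by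
  obtain ⟨q, rfl⟩ : ∃ q, a = q + 5 := ⟨a - 5, by omega⟩
  obtain rfl : r = q + 4 := by omega
  obtain ⟨e, he⟩ : ∃ e, d + e = q + 4 := ⟨q + 4 - d, by omega⟩
  have he2 : e ≤ q + 2 := by omega
  obtain rfl : r' = q + 3 - e := by omega
  obtain ⟨c, rfl⟩ : ∃ c, k = 3 * q + 14 + c := ⟨k - (3 * q + 14), by omega⟩
  have e1 : 3 * q + 14 + c - 1 - 1 - (q + 3 - e) = 2 * q + 9 + c + e := by omega
  have e2 : 3 * q + 14 + c - 1 = 3 * q + 13 + c := by omega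
  have e3 : 3 * q + 14 + c - (q + 5) - 2 = 2 * q + 7 + c := by omega
  have e4 : 3 * q + 14 + c - 1 - (q + 4) = 2 * q + 9 + c := by omega
  have e5 : 3 * q + 14 + c - 2 * (q + 5) - 1 = q + 3 + c := by omega
  have e6 : 3 * q + 14 + c - (q + 5) = 2 * q + 9 + c := by omega
  rw [e1, e2] at hS'
  rw [e3] at hT
  rw [e4, e5]
  rw [e6] at hmd
  have hee : e * e ≤ e * (q + 2) := Nat.mul_le_mul_left e he2
  nlinarith [hS', hT, hmd, hee, he]

/-- The envelope read of `d = 1` on the row `r = a − 1`: `S′ ≤ m′ (k − 1)`, `T + (k − a − 2) ≤ (k − a − 2) + a` —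
EXACTLY the target (the family `B2`, `K_{a,k−a−1}` plus a pendant vertex at the large side). -/
theorem rowB_env_arith (a r k m' S' T : ℕ) (ha : 5 ≤ a) (hr : r + 1 = a) (hk : 2 * a + r ≤ k)
    (hmd : m' + 1 + r = a * (k - a)) (hS' : S' ≤ m' * (k - 1)) (hT : T + (k - a - 2) ≤ 1 * (k - a - 2) + a) :
    S' + 2 * T + 1 + 1 * 1 + r * (k - 1 - r) + 2 * (k - 2 * a - 1) ≤ (m' + 1) * k := by
  obtain ⟨q, rfl⟩ : ∃ q, a = q + 5 := ⟨a - 5, by omega⟩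
  obtain rfl : r = q + 4 := by omega
  obtain ⟨c, rfl⟩ : ∃ c, k = 3 * q + 14 + c := ⟨k - (3 * q + 14), by omega⟩
  have e2 : 3 * q + 14 + c - 1 = 3 * q + 13 + c := by omega
  have e3 : 3 * q + 14 + c - (q + 5) - 2 = 2 * q + 7 + c := by omega
  have e4 : 3 * q + 14 + c - 1 - (q + 4) = 2 * q + 9 + c := by omega
  have e5 : 3 * q + 14 + c - 2 * (q + 5) - 1 = q + 3 + c := by omega
  have e6 : 3 * q + 14 + c - (q + 5) = 2 * q + 9 + c := by omega
  rw [e2] at hS'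
  rw [e3] at hT
  rw [e4, e5]
  rw [e6] at hmd
  nlinarith [hS', hT, hmd]

/-- The deletion of a vertex of degree `a − 1` on the row `r = a − 1` onto the `T` cell `(k − 1, a, a − 2)`
(gap `2 (k − 2a − 2)`), the neighbours at `≤ k − a − 2`: slack `6 + 2q`. -/
theorem rowB_T_arith (a r k m' S' T : ℕ) (ha : 5 ≤ a) (hr : r + 1 = a) (hk : 2 * a + r ≤ k)
    (hmd : m' + (a - 1) + r = a * (k - a))
    (hgap : S' + (a - 2) * (k - 1 - 1 - (a - 2)) + 2 * (k - 1 - 2 * a - 1) ≤ m' * (k - 1))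
    (hT : T ≤ (a - 1) * (k - a - 2)) :
    S' + 2 * T + (a - 1) + (a - 1) * (a - 1) + r * (k - 1 - r) + 2 * (k - 2 * a - 1) ≤ (m' + (a - 1)) * k := by
  obtain ⟨q, rfl⟩ : ∃ q, a = q + 5 := ⟨a - 5, by omega⟩
  obtain rfl : r = q + 4 := by omega
  obtain ⟨c, rfl⟩ : ∃ c, k = 3 * q + 14 + c := ⟨k - (3 * q + 14), by omega⟩
  have e0 : q + 5 - 1 = q + 4 := by omega
  have e1 : q + 5 - 2 = q + 3 := by omega
  have e2 : 3 * q + 14 + c - 1 - 1 - (q + 3) = 2 * q + 9 + c := by omega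
  have e3 : 3 * q + 14 + c - 1 - 2 * (q + 5) - 1 = q + 2 + c := by omega
  have e4 : 3 * q + 14 + c - 1 = 3 * q + 13 + c := by omega
  have e5 : 3 * q + 14 + c - (q + 5) - 2 = 2 * q + 7 + c := by omega
  have e6 : 3 * q + 14 + c - 1 - (q + 4) = 2 * q + 9 + c := by omega
  have e7 : 3 * q + 14 + c - 2 * (q + 5) - 1 = q + 3 + c := by omega
  have e8 : 3 * q + 14 + c - (q + 5) = 2 * q + 9 + c := by omega
  rw [e0] at hmd hT ⊢
  rw [e1, e2, e3, e4] at hgap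
  rw [e5] at hT
  rw [e6, e7]
  rw [e8] at hmd
  nlinarith [hgap, hT, hmd]

end C047

end TriangleCap

end PercRepro
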